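import Summits.Ventures.PercRepro.S1ChainSkew

/-!
# PercRepro — THE CLOSURE FORMULA IN A SKEW UNION OF TRIANGLES (p2, gen 24; SUBCLAIM-S1 §6.9 (vii) step 3)

In a skew union `U = ⋃𝒯` of triangles (`r(U) = 2|𝒯|`, S1ChainSkew) the triangles are pairwise disjoint and the rank of
`A ⊆ U` is `Σ_T min(|A ∩ T|, 2)`. Hence a point `z ∈ U` lies in the closure of `A ⊆ U` iff `z ∈ A` or the triangle of
`z` meets `A` in `≥ 2` points (inserting `z` changes only its own coordinate), the closed traces `cl(A) ∩ U` are the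
sets whose trace on every triangle is empty, a point, or the whole triangle, and ANY TWO CLOSED TRACES FORM A MODULAR
PAIR (coordinatewise: `min(a + b − c, 2) + min(c, 2) = min(a, 2) + min(b, 2)` for traces of sizes `a, b ∈ {0, 1, 3}`).
With `mem_closure_inter_of_modular` this makes the closed traces whose closure contains an outside point `z` a filter
closed under intersection — the principal filter of the principal extension of §6.9 (vi).

* `disjoint_of_skew_union` — the triangles of a skew union are pairwise disjoint;
* **`mem_closure_iff_of_skew_union`** — `z ∈ cl A ↔ z ∈ A ∨ ∃ T ∈ 𝒯, z ∈ T ∧ 2 ≤ |A ∩ T|` for `A, {z} ⊆ U`;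
* a CLOSED TRACE is a subset of `U` whose trace on every triangle has `≤ 1` point or is the triangle (`closedTrace_inter`,
  `ncard_inter_of_closedTrace`: the traces have `0`, `1` or `3` points);
* **`modular_of_closedTrace`** — two closed traces form a modular pair;
* `mem_closure_inter_of_closedTrace` — the filter property.
Axioms: standard.
-/

open scoped Matroid

namespace PercRepro

namespace S1

open Set

variable {α : Type}

/-- In a skew union of triangles the triangles are pairwise disjoint. -/
theorem disjoint_of_skew_union (M : Matroid α) [M.Finite] (𝒯 : Finset (Set α))
    (h𝒯 : ∀ C ∈ 𝒯, M.IsCircuit C ∧ C.ncard = 3) (hskew : M.eRk (⋃ C ∈ 𝒯, C) = 2 * 𝒯.card)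
    {T T' : Set α} (hT : T ∈ 𝒯) (hT' : T' ∈ 𝒯) (hne : T ≠ T') : Disjoint T T' := by
  classical
  rw [Set.disjoint_left]
  intro x hxT hxT'
  have hx : ({x} : Set α) ⊆ ⋃ C ∈ 𝒯, C := by
    intro y hy
    rw [Set.mem_singleton_iff] at hy
    rw [hy]
    exact Set.mem_iUnion₂.2 ⟨T, hT, hxT⟩
  have hsum := eRk_eq_sum_inter_of_skew_union M 𝒯 h𝒯 hskew hx
  have hle : M.eRk {x} ≤ 1 := by
    have := M.eRk_le_encard {x}
    rwa [Set.encard_singleton] at this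
  have h2 : (2 : ℕ∞) ≤ ∑ C ∈ 𝒯, M.eRk ({x} ∩ C) := by
    have hT1 : M.eRk ({x} ∩ T) = 1 := by
      rw [Set.inter_eq_left.2 (Set.singleton_subset_iff.2 hxT)]
      have hI : M.Indep {x} := (h𝒯 T hT).1.ssubset_indep
        ⟨Set.singleton_subset_iff.2 hxT, fun h => by
          have := Set.ncard_le_ncard h (Set.finite_singleton x)
          rw [Set.ncard_singleton, (h𝒯 T hT).2] at this
          omega⟩
      rw [hI.eRk_eq_encard, Set.encard_singleton]
    have hT'1 : M.eRk ({x} ∩ T') = 1 := by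
      rw [Set.inter_eq_left.2 (Set.singleton_subset_iff.2 hxT')]
      have hI : M.Indep {x} := (h𝒯 T' hT').1.ssubset_indep
        ⟨Set.singleton_subset_iff.2 hxT', fun h => by
          have := Set.ncard_le_ncard h (Set.finite_singleton x)
          rw [Set.ncard_singleton, (h𝒯 T' hT').2] at this
          omega⟩
      rw [hI.eRk_eq_encard, Set.encard_singleton]
    calc (2 : ℕ∞) = M.eRk ({x} ∩ T) + M.eRk ({x} ∩ T') := by rw [hT1, hT'1]; norm_num
      _ = ∑ C ∈ ({T, T'} : Finset (Set α)), M.eRk ({x} ∩ C) := by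
          rw [Finset.sum_pair hne]
      _ ≤ ∑ C ∈ 𝒯, M.eRk ({x} ∩ C) := by
          apply Finset.sum_le_sum_of_subset_of_nonneg
          · intro C hC
            rw [Finset.mem_insert, Finset.mem_singleton] at hC
            rcases hC with rfl | rfl <;> assumption
          · intro i _ _
            exact zero_le
  rw [← hsum] at h2
  have : (2 : ℕ∞) ≤ 1 := h2.trans hle
  exact absurd this (by norm_num)

/-- A point of a skew union lies in exactly one of its triangles: the trace of `insert z A` on the other triangles is
the trace of `A`. -/
theorem insert_inter_eq_of_notMem {A T : Set α} {z : α} (hz : z ∉ T) : insert z A ∩ T = A ∩ T := by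
  ext x; simp only [Set.mem_inter_iff, Set.mem_insert_iff]
  constructor
  · rintro ⟨h | h, hT⟩
    · exact absurd (h ▸ hT) hz
    · exact ⟨h, hT⟩
  · rintro ⟨h, hT⟩; exact ⟨Or.inr h, hT⟩

/-- **THE CLOSURE FORMULA IN A SKEW UNION**: for `A ⊆ U = ⋃𝒯` and `z ∈ U`, `z ∈ cl(A)` iff `z ∈ A` or the triangle of
`z` meets `A` in at least two points. -/
theorem mem_closure_iff_of_skew_union (M : Matroid α) [M.Finite] (𝒯 : Finset (Set α))
    (h𝒯 : ∀ C ∈ 𝒯, M.IsCircuit C ∧ C.ncard = 3) (hskew : M.eRk (⋃ C ∈ 𝒯, C) = 2 * 𝒯.card)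
    {A : Set α} (hA : A ⊆ ⋃ C ∈ 𝒯, C) {z : α} (hz : z ∈ ⋃ C ∈ 𝒯, C) :
    z ∈ M.closure A ↔ z ∈ A ∨ ∃ T ∈ 𝒯, z ∈ T ∧ 2 ≤ (A ∩ T).ncard := by
  classical
  have hUE := biUnion_subset_ground M 𝒯 h𝒯
  have hAE : A ⊆ M.E := hA.trans hUE
  have hzE : z ∈ M.E := hUE hz
  obtain ⟨T₀, hT₀, hzT₀⟩ := Set.mem_iUnion₂.1 hz
  have hT₀fin : T₀.Finite := M.ground_finite.subset (h𝒯 T₀ hT₀).1.subset_ground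
  -- the rank of `insert z A` against the rank of `A`, coordinatewise
  have hins : insert z A ⊆ ⋃ C ∈ 𝒯, C := Set.insert_subset hz hA
  have hrA := eRk_eq_sum_inter_of_skew_union M 𝒯 h𝒯 hskew hA
  have hrI := eRk_eq_sum_inter_of_skew_union M 𝒯 h𝒯 hskew hins
  have hother : ∀ C ∈ 𝒯, C ≠ T₀ → M.eRk (insert z A ∩ C) = M.eRk (A ∩ C) := by
    intro C hC hne
    have hd := disjoint_of_skew_union M 𝒯 h𝒯 hskew hC hT₀ hne
    have hzC : z ∉ C := fun h => Set.disjoint_left.1 hd h hzT₀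
    rw [insert_inter_eq_of_notMem hzC]
  by_cases hzA : z ∈ A
  · exact ⟨fun _ => Or.inl hzA, fun _ => M.mem_closure_of_mem hzA hAE⟩
  -- `z ∉ A`: the `T₀`-coordinate grows by one unless `|A ∩ T₀| ≥ 2`
  have hT₀tr : M.eRk (insert z A ∩ T₀) = ((min (insert z A ∩ T₀).ncard 2 : ℕ) : ℕ∞) :=
    eRk_inter_triangle_eq M (h𝒯 T₀ hT₀)
  have hAtr : M.eRk (A ∩ T₀) = ((min (A ∩ T₀).ncard 2 : ℕ) : ℕ∞) := eRk_inter_triangle_eq M (h𝒯 T₀ hT₀)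
  have hcard : (insert z A ∩ T₀).ncard = (A ∩ T₀).ncard + 1 := by
    have e : insert z A ∩ T₀ = insert z (A ∩ T₀) := by
      ext x; simp only [Set.mem_inter_iff, Set.mem_insert_iff]
      constructor
      · rintro ⟨h | h, hT⟩
        · exact Or.inl h
        · exact Or.inr ⟨h, hT⟩
      · rintro (h | ⟨h, hT⟩)
        · exact ⟨Or.inl h, h ▸ hzT₀⟩
        · exact ⟨Or.inr h, hT⟩
    rw [e, Set.ncard_insert_of_notMem (fun h => hzA h.1) (hT₀fin.subset Set.inter_subset_right)]
  -- the two sums differ exactly at `T₀`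
  have hsplitA : ∑ C ∈ 𝒯, M.eRk (A ∩ C) = M.eRk (A ∩ T₀) + ∑ C ∈ 𝒯.erase T₀, M.eRk (A ∩ C) :=
    (Finset.add_sum_erase 𝒯 _ hT₀).symm
  have hsplitI : ∑ C ∈ 𝒯, M.eRk (insert z A ∩ C) =
      M.eRk (insert z A ∩ T₀) + ∑ C ∈ 𝒯.erase T₀, M.eRk (insert z A ∩ C) :=
    (Finset.add_sum_erase 𝒯 _ hT₀).symm
  have hrest : ∑ C ∈ 𝒯.erase T₀, M.eRk (insert z A ∩ C) = ∑ C ∈ 𝒯.erase T₀, M.eRk (A ∩ C) :=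
    Finset.sum_congr rfl (fun C hC => hother C (Finset.mem_of_mem_erase hC) (Finset.ne_of_mem_erase hC))
  rw [hsplitA] at hrA
  rw [hsplitI, hrest] at hrI
  -- `z ∈ cl A ↔ r(insert z A) = r(A)`
  have hiff : z ∈ M.closure A ↔ M.eRk (insert z A) = M.eRk A := by
    constructor
    · intro h
      rw [← M.eRk_closure_eq (insert z A), M.closure_insert_eq_of_mem_closure h, M.eRk_closure_eq]
    · intro h
      by_contra hcon
      have h1 := M.eRk_insert_eq_add_one ⟨hzE, hcon⟩
      rw [h] at h1
      obtain ⟨a, ha⟩ := ENat.ne_top_iff_exists.1 (eRk_ne_top_of_subset M hAE)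
      rw [← ha] at h1
      have : a = a + 1 := by exact_mod_cast h1
      omega
  rw [hiff, hrA, hrI, hT₀tr, hAtr, hcard]
  obtain ⟨s, hs⟩ := ENat.ne_top_iff_exists.1
    (show ∑ C ∈ 𝒯.erase T₀, M.eRk (A ∩ C) ≠ ⊤ from by
      rw [ENat.sum_ne_top]
      intro C _
      exact eRk_ne_top_of_subset M (Set.inter_subset_left.trans hAE))
  rw [← hs]
  constructor
  · intro h
    have h' : min ((A ∩ T₀).ncard + 1) 2 + s = min (A ∩ T₀).ncard 2 + s := by exact_mod_cast h
    right
    refine ⟨T₀, hT₀, hzT₀, ?_⟩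
    omega
  · rintro (h | ⟨T, hT, hzT, h2⟩)
    · exact absurd h hzA
    · have hTT₀ : T = T₀ := by
        by_contra hne
        have hd := disjoint_of_skew_union M 𝒯 h𝒯 hskew hT hT₀ hne
        exact Set.disjoint_left.1 hd hzT hzT₀
      subst hTT₀
      have h' : min ((A ∩ T).ncard + 1) 2 + s = min (A ∩ T).ncard 2 + s := by
        rw [min_eq_right (by omega : 2 ≤ (A ∩ T).ncard + 1), min_eq_right h2]
      exact_mod_cast h'

/-- The intersection of two closed traces is a closed trace. -/
theorem closedTrace_inter (M : Matroid α) [M.Finite] (𝒯 : Finset (Set α))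
    (h𝒯 : ∀ C ∈ 𝒯, M.IsCircuit C ∧ C.ncard = 3) {A B : Set α}
    (hAcl : ∀ T ∈ 𝒯, (A ∩ T).ncard ≤ 1 ∨ T ⊆ A) (hBcl : ∀ T ∈ 𝒯, (B ∩ T).ncard ≤ 1 ∨ T ⊆ B) :
    ∀ T ∈ 𝒯, ((A ∩ B) ∩ T).ncard ≤ 1 ∨ T ⊆ A ∩ B := by
  intro T hT
  have hTfin : T.Finite := M.ground_finite.subset (h𝒯 T hT).1.subset_ground
  rcases hAcl T hT with h | h
  · left
    exact (Set.ncard_le_ncard (Set.inter_subset_inter_left T Set.inter_subset_left)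
      (hTfin.subset Set.inter_subset_right)).trans h
  · rcases hBcl T hT with h' | h'
    · left
      exact (Set.ncard_le_ncard (Set.inter_subset_inter_left T Set.inter_subset_right)
        (hTfin.subset Set.inter_subset_right)).trans h'
    · right
      exact Set.subset_inter h h'

/-- The trace of a closed trace on a triangle has `0`, `1` or `3` points. -/
theorem ncard_inter_of_closedTrace (M : Matroid α) [M.Finite] (𝒯 : Finset (Set α))
    (h𝒯 : ∀ C ∈ 𝒯, M.IsCircuit C ∧ C.ncard = 3) {A : Set α}
    (hAcl : ∀ T ∈ 𝒯, (A ∩ T).ncard ≤ 1 ∨ T ⊆ A) {T : Set α}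
    (hT : T ∈ 𝒯) : (A ∩ T).ncard ≤ 1 ∨ (A ∩ T).ncard = 3 := by
  rcases hAcl T hT with h | h
  · exact Or.inl h
  · right
    rw [Set.inter_eq_right.2 h, (h𝒯 T hT).2]

/-- **TWO CLOSED TRACES FORM A MODULAR PAIR**: `r(A ∪ B) + r(A ∩ B) = r(A) + r(B)` (coordinatewise on the triangles:
`min(a + b − c, 2) + min(c, 2) = min(a, 2) + min(b, 2)` for `a, b ∈ {0, 1, 3}`). -/
theorem modular_of_closedTrace (M : Matroid α) [M.Finite] (𝒯 : Finset (Set α))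
    (h𝒯 : ∀ C ∈ 𝒯, M.IsCircuit C ∧ C.ncard = 3) (hskew : M.eRk (⋃ C ∈ 𝒯, C) = 2 * 𝒯.card)
    {A B : Set α} (hA : A ⊆ ⋃ C ∈ 𝒯, C) (hAcl : ∀ T ∈ 𝒯, (A ∩ T).ncard ≤ 1 ∨ T ⊆ A)
    (hB : B ⊆ ⋃ C ∈ 𝒯, C) (hBcl : ∀ T ∈ 𝒯, (B ∩ T).ncard ≤ 1 ∨ T ⊆ B) :
    M.eRk (A ∪ B) + M.eRk (A ∩ B) = M.eRk A + M.eRk B := by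
  classical
  have hU : A ∪ B ⊆ ⋃ C ∈ 𝒯, C := Set.union_subset hA hB
  have hI : A ∩ B ⊆ ⋃ C ∈ 𝒯, C := Set.inter_subset_left.trans hA
  rw [eRk_eq_sum_inter_of_skew_union M 𝒯 h𝒯 hskew hU, eRk_eq_sum_inter_of_skew_union M 𝒯 h𝒯 hskew hI,
    eRk_eq_sum_inter_of_skew_union M 𝒯 h𝒯 hskew hA, eRk_eq_sum_inter_of_skew_union M 𝒯 h𝒯 hskew hB,
    ← Finset.sum_add_distrib, ← Finset.sum_add_distrib]
  refine Finset.sum_congr rfl (fun T hT => ?_)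
  have hTfin : T.Finite := M.ground_finite.subset (h𝒯 T hT).1.subset_ground
  rw [eRk_inter_triangle_eq M (h𝒯 T hT), eRk_inter_triangle_eq M (h𝒯 T hT), eRk_inter_triangle_eq M (h𝒯 T hT),
    eRk_inter_triangle_eq M (h𝒯 T hT)]
  have e1 : (A ∪ B) ∩ T = (A ∩ T) ∪ (B ∩ T) := Set.union_inter_distrib_right A B T
  have e2 : (A ∩ B) ∩ T = (A ∩ T) ∩ (B ∩ T) := by
    ext x; simp only [Set.mem_inter_iff]; tauto
  have hcard := Set.ncard_union_add_ncard_inter (A ∩ T) (B ∩ T) (hTfin.subset Set.inter_subset_right)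
    (hTfin.subset Set.inter_subset_right)
  rw [← e1, ← e2] at hcard
  have ha := ncard_inter_of_closedTrace M 𝒯 h𝒯 hAcl hT
  have hb := ncard_inter_of_closedTrace M 𝒯 h𝒯 hBcl hT
  have hcI : ((A ∩ B) ∩ T).ncard ≤ (A ∩ T).ncard :=
    Set.ncard_le_ncard (Set.inter_subset_inter_left T Set.inter_subset_left) (hTfin.subset Set.inter_subset_right)
  have hcI' : ((A ∩ B) ∩ T).ncard ≤ (B ∩ T).ncard :=
    Set.ncard_le_ncard (Set.inter_subset_inter_left T Set.inter_subset_right) (hTfin.subset Set.inter_subset_right)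
  have hcU : ((A ∪ B) ∩ T).ncard ≤ T.ncard := Set.ncard_le_ncard Set.inter_subset_right hTfin
  rw [(h𝒯 T hT).2] at hcU
  -- the case `A ∩ T = T` forces `(A ∪ B) ∩ T = T`; likewise for `B`
  have hfull : ∀ {X : Set α}, X ⊆ ⋃ C ∈ 𝒯, C → (X ∩ T).ncard = 3 → X ∩ T = T := by
    intro X _ h3
    exact Set.eq_of_subset_of_ncard_le Set.inter_subset_right (by rw [h3, (h𝒯 T hT).2]) hTfin
  have key : min ((A ∪ B) ∩ T).ncard 2 + min ((A ∩ B) ∩ T).ncard 2 = min (A ∩ T).ncard 2 + min (B ∩ T).ncard 2 := by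
    rcases ha with ha | ha <;> rcases hb with hb | hb
    · omega
    · have := hfull hB hb
      have hsub : T ⊆ (A ∪ B) ∩ T := fun x hx => ⟨Or.inr ((Set.ext_iff.1 this x).2 hx).1, hx⟩
      have h3 : ((A ∪ B) ∩ T).ncard = 3 := by
        have := Set.ncard_le_ncard hsub (hTfin.subset Set.inter_subset_right)
        rw [(h𝒯 T hT).2] at this
        omega
      omega
    · have := hfull hA ha
      have hsub : T ⊆ (A ∪ B) ∩ T := fun x hx => ⟨Or.inl ((Set.ext_iff.1 this x).2 hx).1, hx⟩
      have h3 : ((A ∪ B) ∩ T).ncard = 3 := by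
        have := Set.ncard_le_ncard hsub (hTfin.subset Set.inter_subset_right)
        rw [(h𝒯 T hT).2] at this
        omega
      omega
    · omega
  exact_mod_cast key

/-- **THE FILTER PROPERTY**: if an outside point `z` lies in the closures of two closed traces, it lies in the
closure of their intersection. -/
theorem mem_closure_inter_of_closedTrace (M : Matroid α) [M.Finite] (𝒯 : Finset (Set α))
    (h𝒯 : ∀ C ∈ 𝒯, M.IsCircuit C ∧ C.ncard = 3) (hskew : M.eRk (⋃ C ∈ 𝒯, C) = 2 * 𝒯.card)
    {A B : Set α} (hA : A ⊆ ⋃ C ∈ 𝒯, C) (hAcl : ∀ T ∈ 𝒯, (A ∩ T).ncard ≤ 1 ∨ T ⊆ A)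
    (hB : B ⊆ ⋃ C ∈ 𝒯, C) (hBcl : ∀ T ∈ 𝒯, (B ∩ T).ncard ≤ 1 ∨ T ⊆ B) {z : α} (hz : z ∈ M.E)
    (hzA : z ∈ M.closure A) (hzB : z ∈ M.closure B) : z ∈ M.closure (A ∩ B) :=
  mem_closure_inter_of_modular M (hA.trans (biUnion_subset_ground M 𝒯 h𝒯))
    (hB.trans (biUnion_subset_ground M 𝒯 h𝒯)) (modular_of_closedTrace M 𝒯 h𝒯 hskew hA hAcl hB hBcl) hz hzA hzB

end S1

end PercRepro
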